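import Literature.MathematicalPhysics.QuantumFieldTheory.Balaban1983to89.T3AlphaInputsACTwoRunLevel
import Literature.MathematicalPhysics.QuantumFieldTheory.Balaban1983to89.T3Thresholds

/-!
# Crux-ideate sketch g9 (ideator 1, TRANSFER lens; stmt-QuantumFields-19201 / live twin stmt-QuantumFields-19935) — card 9 «flat-kernel-taylor-port»

KING'S §4 PORTED TO SU(2) YM₃: the two-cut-off row `PolymerCauchyMinAtT` (the (C) piece of `TwoRunMinT`) after TAYLOR EXPANSION OF THE BIRTH CHARTS AT THE
FLAT POINT to print's order six ([Balaban1985UV3] (33)–(34) p.264 «polynomials in B of at least the second and at most the sixth order», (57) p.270 «terms with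
an overall power greater than six» go to the remainder).  The Taylor coefficients `E K i Y p c` (order `2 ≤ p ≤ 6`, bonds `c : Fin p → PBond`) are
FIELD-INDEPENDENT numbers = connected graphs of the step-`i` fluctuation integral at the FLAT background (block-translation-invariant ⇒ block-Fourier
representation, [King1986] (4.2)/(4.19), [Balaban1984PropagatorsI] §1), so King's mechanism — continuum-symbol anchor (4.10)/(4.18), factor-by-factor
replacement with a Hölder sacrifice (4.24)–(4.28), resolvent interpolation Lemma 4.5 (4.32)–(4.41), slice assembly (4.42) — transfers to them verbatim
(`FlatKernelCauchy`, the line's K1a).  The background enters only through the chart configurations (card 8 `ChartFactor`; their two-run Cauchy row is card 5 /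
stmt-19200) and through the order-≥7 remainder, which carries `θ(n)⁷` and is absorbed by an ADDITIVE SLACK (`PolymerCauchyMinAtTSlack`, design remark
F-idea1-g9-1: King's Thm 3.4 itself carries the slack `(L^kε)^σ|T|`; the socket `PolymerCauchyAtT` reads the row only at `n = ⌊K/m⌋`, where
`Σ_Y e^{−κ𝓛} θ(n)^σ ~ L^{3n}θ(n)^σ` is summable iff `σ > 6` — print's «six»).

§1 the slack row + `slack_of_pure` (the slack row is WEAKER than the typed one; proved).  §2 the Taylor data: `TaylorSplit` (structure row), `FlatKernelCauchy`
(K1a, the unprinted NUMBER comparison = [King1986] Prop. 3.6/(3.56) for SU(2)), `KernelSize` ((34) printed type), `RemainderSmall` ((57) + Cauchy estimates),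
`CfgSize`/`CfgCauchy` (card 8's configuration rows, scalar coordinates), and the line's composition `polymerCauchyMinAtTSlack_of_taylor` (PROVED: multilinear
telescoping `abs_prod_sub_prod_le` + `per_order` + `taylor_core`; no estimate of [Balaban1985UV3] is proved — only the algebra of the rows).  §3 scalar bookkeeping of the order-`p` absorption (proved).
Colour indices of the chart variables are suppressed (`𝕍 = ℝ` coordinates); nothing here is asserted about [Balaban1985UV3].

References: C. King, CMP 102 (1986) 649–677 [King1986] (Thm 3.4 (3.9), (3.43)–(3.56), Props 3.6–3.9, §4 (4.2)–(4.43)); T. Bałaban, CMP 102 (1985) 255–275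
[Balaban1985UV3] ((27)–(29), (32)–(34), (43)–(44), (57)); T. Bałaban, CMP 99 (1985) 75–102 [Balaban1984PropagatorsI].
-/

set_option autoImplicit false

noncomputable section

open scoped BigOperators
open Literature.MathematicalPhysics.QuantumFieldTheory.Balaban1983to89
open Literature.MathematicalPhysics.QuantumFieldTheory.Balaban1983to89.T3ContinuumYM3Torus
open Literature.MathematicalPhysics.QuantumFieldTheory.Balaban1983to89.T3UnitScaleTilt
open Literature.MathematicalPhysics.QuantumFieldTheory.Balaban1983to89.T3LevelShift
open Literature.MathematicalPhysics.QuantumFieldTheory.Balaban1983to89.T3AlphaInputsAC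
open Literature.MathematicalPhysics.QuantumFieldTheory.Balaban1983to89.T3AlphaPolymerSocket
open Literature.MathematicalPhysics.QuantumFieldTheory.Balaban1983to89.T3AlphaInputsACTwoRun
open Literature.MathematicalPhysics.QuantumFieldTheory.Balaban1983to89.T3AlphaInputsACTwoRunLevel

namespace Summit.QuantumFields.YangMills.Cruxes.FluctuationComparisonRegPr.Ideate1Flat

/-! ## §0 Data shapes (scalar chart coordinates) -/

/-- The bond matching of the two runs (level `i` of run `K` ≃ level `i+1` of run `K+1`; `T3LevelShift.bondShift`). [cite: Balaban1987RG1, (0.1) p.251] -/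
def matchBond (F : T3Family) (K i : ℕ) : PBond (F.P K) i ≃ PBond (F.P (K + 1)) (i + 1) :=
  bondShift (F.sitesPerDir_eq (m := F.m) (K := K) (j := i) (m' := F.m) (K' := K + 1) (j' := i + 1) (by omega))

/-- Flat Taylor kernels: run `K`, birth level `i`, domain `Y`, order `p`, bond multi-index `c` ↦ the coefficient of `∏ₗ B(c l)` in the birth chart
`𝒫⁽ⁱ⁾(g_i, Y, B)` — a NUMBER ([King1986] (3.55): the graphs `Ẽ(H̃; {y},{z},{w})` with the fields pulled out). [cite: King1986, (3.55) p.662] -/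
abbrev Kernel (F : T3Family) : Type :=
  (K i : ℕ) → Set (Site (F.P K) 0) → (p : ℕ) → (Fin p → PBond (F.P K) i) → ℝ

/-- Scalar chart-configuration maps (run, height, level, domain, height-field ↦ bond coordinates; card 8's `CfgMap` with `𝕍 = ℝ`). [cite: Balaban1985UV3, (27) p.263] -/
abbrev CfgMapR (F : T3Family) : Type :=
  (K k i : ℕ) → Set (Site (F.P K) 0) → GaugeField (F.P K) k (Matrix.specialUnitaryGroup (Fin 2) ℂ) → PBond (F.P K) i → ℝ

/-- Remainders (order ≥ 7 part of a term, read at a height field). [cite: Balaban1985UV3, (57) p.270] -/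
abbrev Remainder (F : T3Family) : Type :=
  (K k i : ℕ) → Set (Site (F.P K) 0) → GaugeField (F.P K) k (Matrix.specialUnitaryGroup (Fin 2) ℂ) → ℝ

/-- Polydisc radii of the birth charts. [cite: Balaban1985UV3, (28) p.263] -/
abbrev Radius (F : T3Family) : Type :=
  (K i : ℕ) → Set (Site (F.P K) 0) → PBond (F.P K) i → ℝ

section Schemas

variable {F : T3Family} {γ : ℝ}

/-! ## §1 The slack row (design remark F-idea1-g9-1) -/

/-- **THE TWO-CUT-OFF ROW WITH KING'S SLACK** (proposal, never asserted): `PolymerCauchyMinAtT` with the per-polymer budget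
`C·e^{−κ₁𝓛}·L^{−4(K−n−1−j)}·(θ(n)²·(L^{−(1+j)})^a + θ(n)^σ)` — the additive `θ(n)^σ` is [King1986] Thm 3.4's `(L^kε)^σ|T|` per polymer; at the socket's
height `n = ⌊K/m⌋` it sums to `~L^{3n}θ(n)^σ`, summable in `K` iff `σ > 6`. [cite: King1986, Thm. 3.4 (3.9) p.656] -/
def PolymerCauchyMinAtTSlack (D : AlphaDataT3 F γ) (PT : TermFn F) (b₀ p₀ κ₁ a : ℝ) (σ : ℕ) (C : ℝ) : Prop :=
  ∃ c : (K n j : ℕ) → Set (Site (F.P K) 0) → ℝ,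
    ∀ (K n : ℕ) (h : n ≤ K), ∀ j : ℕ, j < K - n →
      ∀ V : GaugeField (F.P n) 0 (Matrix.specialUnitaryGroup (Fin 2) ℂ), PlaqSmall (θBal F.L γ b₀ p₀ n) V →
        ∀ Y ∈ D.Loc K (K - n) (D.triv K (K - n)) (1 + j),
          |PT (K + 1) (K + 1 - n) (1 + (j + 1)) (refineSet F K Y)
              (fieldShift (F.sitesPerDir_eq (m := F.m) (K := K + 1) (j := K + 1 - n) (m' := F.m) (K' := n) (j' := 0) (by omega)) V) -
            PT K (K - n) (1 + j) Y
              (fieldShift (F.sitesPerDir_eq (m := F.m) (K := K) (j := K - n) (m' := F.m) (K' := n) (j' := 0) (by omega)) V) -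
            c K n j Y| ≤
          C * Real.exp (-κ₁ * D.treeLen K (1 + j) Y) * (((F.L : ℝ) ^ (K - n - 1 - j))⁻¹) ^ 4 *
            (θBal F.L γ b₀ p₀ n ^ 2 * (((F.L : ℝ) ^ (1 + j))⁻¹) ^ a + θBal F.L γ b₀ p₀ n ^ σ)

/-- The slack row is implied by the typed row (the slack is a WEAKENING; `C ≥ 0`, `θ ≥ 0`). [folklore] -/
theorem slack_of_pure {D : AlphaDataT3 F γ} {PT : TermFn F} {b₀ p₀ κ₁ a C : ℝ} (σ : ℕ) (hC : 0 ≤ C)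
    (hθ : ∀ n, 0 ≤ θBal F.L γ b₀ p₀ n) (h : PolymerCauchyMinAtT D PT b₀ p₀ κ₁ a C) :
    PolymerCauchyMinAtTSlack D PT b₀ p₀ κ₁ a σ C := by
  obtain ⟨c, hc⟩ := h
  refine ⟨c, ?_⟩
  intro K n hn j hj V hV Y hY
  refine (hc K n hn j hj V hV Y hY).trans ?_
  have hP : 0 ≤ C * Real.exp (-κ₁ * D.treeLen K (1 + j) Y) * (((F.L : ℝ) ^ (K - n - 1 - j))⁻¹) ^ 4 :=
    mul_nonneg (mul_nonneg hC (Real.exp_pos _).le) (by positivity)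
  have hσ : 0 ≤ θBal F.L γ b₀ p₀ n ^ σ := pow_nonneg (hθ n) σ
  have hmain : C * Real.exp (-κ₁ * D.treeLen K (1 + j) Y) * θBal F.L γ b₀ p₀ n ^ 2 *
        (((F.L : ℝ) ^ (K - n - 1 - j))⁻¹) ^ 4 * (((F.L : ℝ) ^ (1 + j))⁻¹) ^ a =
      C * Real.exp (-κ₁ * D.treeLen K (1 + j) Y) * (((F.L : ℝ) ^ (K - n - 1 - j))⁻¹) ^ 4 *
        (θBal F.L γ b₀ p₀ n ^ 2 * (((F.L : ℝ) ^ (1 + j))⁻¹) ^ a) := by ring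
  rw [hmain, mul_add]
  exact le_add_of_nonneg_right (mul_nonneg hP hσ)

/-! ## §2 The Taylor data of the line -/

/-- **STRUCTURE ROW (Taylor form of the chart factorisation)**: the term = Σ_{p=2}^{6} Σ_c E(p,c)·∏ₗ B(cₗ) + remainder, `E` height-free.  (Card 8's
`ChartFactor` with `Φ K i Y` written as its order-six Taylor polynomial at the flat point plus the rest; first order absent by (32).)
[cite: Balaban1985UV3, (32)-(34) p.264, (43) p.266, (57) p.270] -/
def TaylorSplit (PT : TermFn F) (E : Kernel F) (B : CfgMapR F) (R : Remainder F) : Prop :=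
  ∀ (K k i : ℕ) (Y : Set (Site (F.P K) 0)) (W : GaugeField (F.P K) k (Matrix.specialUnitaryGroup (Fin 2) ℂ)),
    PT K k i Y W = (∑ p ∈ Finset.Icc 2 6, ∑ c : Fin p → PBond (F.P K) i, E K i Y p c * ∏ l, B K k i Y W (c l)) + R K k i Y W

/-- **K1a — FLAT-KERNEL CAUCHY ROW (the unprinted NUMBER comparison; [King1986] Prop. 3.6 (3.56) for SU(2))**: the order-`p` kernels (`2 ≤ p ≤ 6`) of the
matched levels `i` (run `K`, domain `Y`) and `i+1` (run `K+1`, domain `refineSet Y`), bonds identified by `matchBond`, differ in the radius-weighted ℓ¹ norm by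
`C·e^{−κ𝓛_K(Y)}·(L^{−i})^a`.  Flat background ⇒ block-Fourier analysis ([King1986] §4) applies. [cite: King1986, Prop. 3.6 (3.56) p.662, Prop. 3.9 (3.74) p.665] -/
def FlatKernelCauchy (D : AlphaDataT3 F γ) (E : Kernel F) (r : Radius F) (κ a C : ℝ) : Prop :=
  ∀ (K k i : ℕ) (Y : Set (Site (F.P K) 0)), Y ∈ D.Loc K k (D.triv K k) i →
    ∀ p ∈ Finset.Icc 2 6,
      ∑ c : Fin p → PBond (F.P K) i,
          |E (K + 1) (i + 1) (refineSet F K Y) p (fun l => matchBond F K i (c l)) - E K i Y p c| * ∏ l, r K i Y (c l) ≤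
        C * Real.exp (-κ * D.treeLen K i Y) * (((F.L : ℝ) ^ i)⁻¹) ^ a

/-- **KERNEL SIZE ROW** (printed type: Cauchy estimates for the analytic chart on the polydisc, Prop. 3 / (34) of [Balaban1985UV3]).
[cite: Balaban1985UV3, Prop. 3 (34) p.264] -/
def KernelSize (D : AlphaDataT3 F γ) (E : Kernel F) (r : Radius F) (κ C_E : ℝ) : Prop :=
  ∀ (K k i : ℕ) (Y : Set (Site (F.P K) 0)), Y ∈ D.Loc K k (D.triv K k) i →
    ∀ p ∈ Finset.Icc 2 6, ∑ c : Fin p → PBond (F.P K) i, |E K i Y p c| * ∏ l, r K i Y (c l) ≤ C_E * Real.exp (-κ * D.treeLen K i Y)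

/-- **REMAINDER ROW** (printed (57) «power greater than six» + Cauchy estimates + configuration size): at the trivial history and a `θ(n)`-small level-`n` datum
the order-≥7 rest of a level-`(1+j)` term read at height `K−n` is `≤ C_R·e^{−κ𝓛}·θ(n)⁷·L^{−14(K−n−1−j)}`, in BOTH runs. [cite: Balaban1985UV3, (57) p.270] -/
def RemainderSmall (D : AlphaDataT3 F γ) (R : Remainder F) (b₀ p₀ κ C_R : ℝ) : Prop :=
  ∀ (K n : ℕ) (h : n ≤ K), ∀ j : ℕ, j < K - n →
    ∀ V : GaugeField (F.P n) 0 (Matrix.specialUnitaryGroup (Fin 2) ℂ), PlaqSmall (θBal F.L γ b₀ p₀ n) V →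
      ∀ Y ∈ D.Loc K (K - n) (D.triv K (K - n)) (1 + j),
        |R K (K - n) (1 + j) Y
            (fieldShift (F.sitesPerDir_eq (m := F.m) (K := K) (j := K - n) (m' := F.m) (K' := n) (j' := 0) (by omega)) V)| ≤
          C_R * Real.exp (-κ * D.treeLen K (1 + j) Y) * θBal F.L γ b₀ p₀ n ^ 7 * (((F.L : ℝ) ^ (K - n - 1 - j))⁻¹) ^ 14 ∧
        |R (K + 1) (K + 1 - n) (1 + (j + 1)) (refineSet F K Y)
            (fieldShift (F.sitesPerDir_eq (m := F.m) (K := K + 1) (j := K + 1 - n) (m' := F.m) (K' := n) (j' := 0) (by omega)) V)| ≤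
          C_R * Real.exp (-κ * D.treeLen K (1 + j) Y) * θBal F.L γ b₀ p₀ n ^ 7 * (((F.L : ℝ) ^ (K - n - 1 - j))⁻¹) ^ 14

/-- **CONFIGURATION SIZE ROW** (card 8 `ChartCfgSize`, scalar coordinates). [cite: Balaban1985UV3, (28) p.263, (44) p.267] -/
def CfgSize (D : AlphaDataT3 F γ) (B : CfgMapR F) (r : Radius F) (b₀ p₀ C_s : ℝ) : Prop :=
  ∀ (K n : ℕ) (h : n ≤ K), ∀ j : ℕ, j < K - n →
    ∀ V : GaugeField (F.P n) 0 (Matrix.specialUnitaryGroup (Fin 2) ℂ), PlaqSmall (θBal F.L γ b₀ p₀ n) V →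
      ∀ Y ∈ D.Loc K (K - n) (D.triv K (K - n)) (1 + j), ∀ c : PBond (F.P K) (1 + j),
        |B K (K - n) (1 + j) Y
            (fieldShift (F.sitesPerDir_eq (m := F.m) (K := K) (j := K - n) (m' := F.m) (K' := n) (j' := 0) (by omega)) V) c| ≤
          C_s * θBal F.L γ b₀ p₀ n * (((F.L : ℝ) ^ (K - n - 1 - j))⁻¹) ^ 2 * r K (1 + j) Y c ∧
        |B (K + 1) (K + 1 - n) (1 + (j + 1)) (refineSet F K Y)
            (fieldShift (F.sitesPerDir_eq (m := F.m) (K := K + 1) (j := K + 1 - n) (m' := F.m) (K' := n) (j' := 0) (by omega)) V)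
            (matchBond F K (1 + j) c)| ≤
          C_s * θBal F.L γ b₀ p₀ n * (((F.L : ℝ) ^ (K - n - 1 - j))⁻¹) ^ 2 * r K (1 + j) Y c

/-- **CONFIGURATION CAUCHY ROW** (card 8 `ChartCfgCauchy` = card 5 / stmt-19200 in chart currency, scalar coordinates). [cite: King1986, Prop. 3.9 (3.71) p.665] -/
def CfgCauchy (D : AlphaDataT3 F γ) (B : CfgMapR F) (r : Radius F) (b₀ p₀ a C_B : ℝ) : Prop :=
  ∀ (K n : ℕ) (h : n ≤ K), ∀ j : ℕ, j < K - n →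
    ∀ V : GaugeField (F.P n) 0 (Matrix.specialUnitaryGroup (Fin 2) ℂ), PlaqSmall (θBal F.L γ b₀ p₀ n) V →
      ∀ Y ∈ D.Loc K (K - n) (D.triv K (K - n)) (1 + j), ∀ c : PBond (F.P K) (1 + j),
        |B (K + 1) (K + 1 - n) (1 + (j + 1)) (refineSet F K Y)
              (fieldShift (F.sitesPerDir_eq (m := F.m) (K := K + 1) (j := K + 1 - n) (m' := F.m) (K' := n) (j' := 0) (by omega)) V)
              (matchBond F K (1 + j) c) -
            B K (K - n) (1 + j) Y
              (fieldShift (F.sitesPerDir_eq (m := F.m) (K := K) (j := K - n) (m' := F.m) (K' := n) (j' := 0) (by omega)) V) c| ≤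
          C_B * θBal F.L γ b₀ p₀ n * (((F.L : ℝ) ^ (K - n - 1 - j))⁻¹) ^ 2 * (((F.L : ℝ) ^ (1 + j))⁻¹) ^ a * r K (1 + j) Y c

/-! ### §2b The telescoping algebra (proved) -/

/-- Reindex a sum over bond multi-indices of run `K+1` through the bond matching. [folklore] -/
theorem sum_reindex {ι ι' : Type*} [Fintype ι] [Fintype ι'] (m : ι ≃ ι') (p : ℕ) (G : (Fin p → ι') → ℝ) :
    ∑ c' : Fin p → ι', G c' = ∑ c : Fin p → ι, G (fun l => m (c l)) :=
  (Fintype.sum_equiv (Equiv.arrowCongr (Equiv.refl (Fin p)) m) (fun c => G (fun l => m (c l))) G (fun _ => rfl)).symm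

/-- A monomial on the polydisc shrunk by `s`: `|∏ₗ xₗ| ≤ s^p·∏ₗ rₗ`. [folklore] -/
theorem abs_prod_le {p : ℕ} {x r : Fin p → ℝ} {s : ℝ} (hx : ∀ l, |x l| ≤ s * r l) :
    |∏ l, x l| ≤ s ^ p * ∏ l, r l := by
  rw [Finset.abs_prod]
  calc ∏ l, |x l| ≤ ∏ l, (s * r l) := Finset.prod_le_prod (fun l _ => abs_nonneg _) (fun l _ => hx l)
    _ = s ^ p * ∏ l, r l := by rw [Finset.prod_mul_distrib, Finset.prod_const, Finset.card_univ, Fintype.card_fin]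

/-- Multilinear telescoping: two monomials on the `s`-shrunk polydisc whose variables differ by `t·r` differ by `p·s^{p−1}·t·∏r`. [folklore] -/
theorem abs_prod_sub_prod_le {s t : ℝ} (hs : 0 ≤ s) (ht : 0 ≤ t) :
    ∀ (p : ℕ) (x y r : Fin p → ℝ), (∀ l, 0 ≤ r l) → (∀ l, |x l| ≤ s * r l) → (∀ l, |y l| ≤ s * r l) →
      (∀ l, |x l - y l| ≤ t * r l) → |∏ l, x l - ∏ l, y l| ≤ p * s ^ (p - 1) * t * ∏ l, r l := by
  intro p
  induction p with
  | zero => intro x y r _ _ _ _; simp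
  | succ p ih =>
    intro x y r hr hx hy hxy
    simp only [Fin.prod_univ_succ]
    have hX : |∏ l : Fin p, x l.succ| ≤ s ^ p * ∏ l : Fin p, r l.succ := abs_prod_le (fun l => hx _)
    have hXY : |∏ l : Fin p, x l.succ - ∏ l : Fin p, y l.succ| ≤ p * s ^ (p - 1) * t * ∏ l : Fin p, r l.succ :=
      ih (fun l => x l.succ) (fun l => y l.succ) (fun l => r l.succ) (fun l => hr _) (fun l => hx _) (fun l => hy _) (fun l => hxy _)
    have hRr : 0 ≤ ∏ l : Fin p, r l.succ := Finset.prod_nonneg fun l _ => hr _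
    have hsp : s * ((p : ℝ) * s ^ (p - 1)) ≤ (p : ℝ) * s ^ p := by
      rcases Nat.eq_zero_or_pos p with rfl | hp
      · simp
      · obtain ⟨q, rfl⟩ : ∃ q, p = q + 1 := ⟨p - 1, by omega⟩
        simp only [Nat.add_sub_cancel, pow_succ]
        nlinarith [pow_nonneg hs q]
    have key : x 0 * ∏ l : Fin p, x l.succ - y 0 * ∏ l : Fin p, y l.succ =
        (x 0 - y 0) * ∏ l : Fin p, x l.succ + y 0 * (∏ l : Fin p, x l.succ - ∏ l : Fin p, y l.succ) := by ring
    rw [key]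
    have h0 : 0 ≤ t * r 0 := mul_nonneg ht (hr 0)
    have h1 : 0 ≤ s * r 0 := mul_nonneg hs (hr 0)
    have hTRR : 0 ≤ t * r 0 * ∏ l : Fin p, r l.succ := mul_nonneg h0 hRr
    calc |(x 0 - y 0) * ∏ l : Fin p, x l.succ + y 0 * (∏ l : Fin p, x l.succ - ∏ l : Fin p, y l.succ)|
        ≤ |x 0 - y 0| * |∏ l : Fin p, x l.succ| + |y 0| * |∏ l : Fin p, x l.succ - ∏ l : Fin p, y l.succ| := by
          rw [← abs_mul, ← abs_mul]; exact abs_add_le _ _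
      _ ≤ (t * r 0) * (s ^ p * ∏ l : Fin p, r l.succ) + (s * r 0) * (p * s ^ (p - 1) * t * ∏ l : Fin p, r l.succ) :=
          add_le_add (mul_le_mul (hxy 0) hX (abs_nonneg _) h0) (mul_le_mul (hy 0) hXY (abs_nonneg _) h1)
      _ = t * r 0 * (∏ l : Fin p, r l.succ) * s ^ p + (s * ((p : ℝ) * s ^ (p - 1))) * (t * r 0 * ∏ l : Fin p, r l.succ) := by ring
      _ ≤ t * r 0 * (∏ l : Fin p, r l.succ) * s ^ p + ((p : ℝ) * s ^ p) * (t * r 0 * ∏ l : Fin p, r l.succ) :=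
          add_le_add le_rfl (mul_le_mul_of_nonneg_right hsp hTRR)
      _ = ((p + 1 : ℕ) : ℝ) * s ^ (p + 1 - 1) * t * (r 0 * ∏ l : Fin p, r l.succ) := by
          simp only [Nat.add_sub_cancel, Nat.cast_add, Nat.cast_one]; ring

/-- **ONE TAYLOR ORDER**: `|Σ_{c′} E′Π B′ − Σ_c EΠ B| ≤ s²·(Ce ρ) + 6·s·t·(C_E e)` on the `s`-shrunk polydisc (`s ≤ 1`, `2 ≤ p ≤ 6`), from the kernel Cauchy row,
the kernel size row and the configuration rows. [cite: King1986, (3.57) p.662] -/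
theorem per_order {ι ι' : Type*} [Fintype ι] [Fintype ι'] (m : ι ≃ ι') {p : ℕ} (hp2 : 2 ≤ p) (hp6 : p ≤ 6)
    (E : (Fin p → ι) → ℝ) (E' : (Fin p → ι') → ℝ) (B₀ : ι → ℝ) (B₁ : ι' → ℝ) (r : ι → ℝ)
    {s t e ρ C C_E : ℝ} (hs0 : 0 ≤ s) (hs1 : s ≤ 1) (ht : 0 ≤ t) (hr : ∀ c, 0 ≤ r c)
    (hB₀ : ∀ c, |B₀ c| ≤ s * r c) (hB₁ : ∀ c, |B₁ (m c)| ≤ s * r c) (hΔ : ∀ c, |B₁ (m c) - B₀ c| ≤ t * r c)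
    (hK : ∑ c : Fin p → ι, |E' (fun l => m (c l)) - E c| * ∏ l, r (c l) ≤ C * e * ρ)
    (hE : ∑ c : Fin p → ι, |E c| * ∏ l, r (c l) ≤ C_E * e) :
    |∑ c' : Fin p → ι', E' c' * ∏ l, B₁ (c' l) - ∑ c : Fin p → ι, E c * ∏ l, B₀ (c l)| ≤
      s ^ 2 * (C * e * ρ) + 6 * s * t * (C_E * e) := by
  rw [sum_reindex m p, ← Finset.sum_sub_distrib]
  refine (Finset.abs_sum_le_sum_abs _ _).trans ?_
  have hpt : ∀ c : Fin p → ι,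
      |E' (fun l => m (c l)) * ∏ l, B₁ (m (c l)) - E c * ∏ l, B₀ (c l)| ≤
        s ^ p * (|E' (fun l => m (c l)) - E c| * ∏ l, r (c l)) + (p * s ^ (p - 1) * t) * (|E c| * ∏ l, r (c l)) := by
    intro c
    have hP1 : |∏ l, B₁ (m (c l))| ≤ s ^ p * ∏ l, r (c l) := abs_prod_le (fun l => hB₁ _)
    have hPd : |∏ l, B₁ (m (c l)) - ∏ l, B₀ (c l)| ≤ p * s ^ (p - 1) * t * ∏ l, r (c l) :=
      abs_prod_sub_prod_le hs0 ht p (fun l => B₁ (m (c l))) (fun l => B₀ (c l)) (fun l => r (c l))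
        (fun l => hr _) (fun l => hB₁ _) (fun l => hB₀ _) (fun l => hΔ _)
    have key : E' (fun l => m (c l)) * ∏ l, B₁ (m (c l)) - E c * ∏ l, B₀ (c l) =
        (E' (fun l => m (c l)) - E c) * ∏ l, B₁ (m (c l)) + E c * (∏ l, B₁ (m (c l)) - ∏ l, B₀ (c l)) := by ring
    rw [key]
    calc |(E' (fun l => m (c l)) - E c) * ∏ l, B₁ (m (c l)) + E c * (∏ l, B₁ (m (c l)) - ∏ l, B₀ (c l))|
        ≤ |E' (fun l => m (c l)) - E c| * |∏ l, B₁ (m (c l))| + |E c| * |∏ l, B₁ (m (c l)) - ∏ l, B₀ (c l)| := by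
          rw [← abs_mul, ← abs_mul]; exact abs_add_le _ _
      _ ≤ |E' (fun l => m (c l)) - E c| * (s ^ p * ∏ l, r (c l)) + |E c| * (p * s ^ (p - 1) * t * ∏ l, r (c l)) :=
          add_le_add (mul_le_mul_of_nonneg_left hP1 (abs_nonneg _)) (mul_le_mul_of_nonneg_left hPd (abs_nonneg _))
      _ = _ := by ring
  refine (Finset.sum_le_sum fun c _ => hpt c).trans ?_
  rw [Finset.sum_add_distrib, ← Finset.mul_sum, ← Finset.mul_sum]
  have h1 : s ^ p ≤ s ^ 2 := pow_le_pow_of_le_one hs0 hs1 hp2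
  have h2 : (p : ℝ) * s ^ (p - 1) ≤ 6 * s := by
    have h' : s ^ (p - 1) ≤ s ^ 1 := pow_le_pow_of_le_one hs0 hs1 (by omega)
    rw [pow_one] at h'
    have hp6' : (p : ℝ) ≤ 6 := by exact_mod_cast hp6
    exact mul_le_mul hp6' h' (pow_nonneg hs0 _) (by norm_num)
  have hKnn : 0 ≤ C * e * ρ :=
    le_trans (Finset.sum_nonneg fun c _ => mul_nonneg (abs_nonneg _) (Finset.prod_nonneg fun l _ => hr _)) hK
  have hEnn : 0 ≤ C_E * e :=
    le_trans (Finset.sum_nonneg fun c _ => mul_nonneg (abs_nonneg _) (Finset.prod_nonneg fun l _ => hr _)) hE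
  have hsp0 : 0 ≤ s ^ p := pow_nonneg hs0 _
  have hpt0 : 0 ≤ (p : ℝ) * s ^ (p - 1) * t := mul_nonneg (mul_nonneg (Nat.cast_nonneg _) (pow_nonneg hs0 _)) ht
  calc s ^ p * ∑ c : Fin p → ι, |E' (fun l => m (c l)) - E c| * ∏ l, r (c l) +
        (p * s ^ (p - 1) * t) * ∑ c : Fin p → ι, |E c| * ∏ l, r (c l)
      ≤ s ^ p * (C * e * ρ) + (p * s ^ (p - 1) * t) * (C_E * e) :=
        add_le_add (mul_le_mul_of_nonneg_left hK hsp0) (mul_le_mul_of_nonneg_left hE hpt0)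
    _ ≤ s ^ 2 * (C * e * ρ) + (6 * s * t) * (C_E * e) := by
        have h2' : (p : ℝ) * s ^ (p - 1) * t ≤ 6 * s * t := mul_le_mul_of_nonneg_right h2 ht
        exact add_le_add (mul_le_mul_of_nonneg_right h1 hKnn) (mul_le_mul_of_nonneg_right h2' hEnn)
    _ = _ := by ring

/-- **THE TAYLOR CORE (orders 2..6 + two remainders), scalars abstracted**: the composition of the five rows at one `(K, n, j, V, Y)`.
[cite: King1986, Prop. 3.6 (3.56)-(3.57) p.662] -/
theorem taylor_core {ι ι' : Type*} [Fintype ι] [Fintype ι'] (m : ι ≃ ι')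
    (E : (p : ℕ) → (Fin p → ι) → ℝ) (E' : (p : ℕ) → (Fin p → ι') → ℝ) (B₀ : ι → ℝ) (B₁ : ι' → ℝ) (r : ι → ℝ) (R₀ R₁ : ℝ)
    {θ x ρ e C C_E C_R C_s C_B : ℝ}
    (hθ : 0 ≤ θ) (hsθ : C_s * θ ≤ 1) (hx0 : 0 ≤ x) (hx1 : x ≤ 1) (hρ : 0 ≤ ρ) (he : 0 ≤ e)
    (hC : 0 ≤ C) (hCE : 0 ≤ C_E) (hCR : 0 ≤ C_R) (hCs : 0 ≤ C_s) (hCB : 0 ≤ C_B) (hr : ∀ c, 0 ≤ r c)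
    (hB₀ : ∀ c, |B₀ c| ≤ C_s * θ * x ^ 2 * r c) (hB₁ : ∀ c, |B₁ (m c)| ≤ C_s * θ * x ^ 2 * r c)
    (hΔ : ∀ c, |B₁ (m c) - B₀ c| ≤ C_B * θ * x ^ 2 * ρ * r c)
    (hK : ∀ p ∈ Finset.Icc 2 6, ∑ c : Fin p → ι, |E' p (fun l => m (c l)) - E p c| * ∏ l, r (c l) ≤ C * e * ρ)
    (hE : ∀ p ∈ Finset.Icc 2 6, ∑ c : Fin p → ι, |E p c| * ∏ l, r (c l) ≤ C_E * e)
    (hR₀ : |R₀| ≤ C_R * e * θ ^ 7 * x ^ 14) (hR₁ : |R₁| ≤ C_R * e * θ ^ 7 * x ^ 14) :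
    |(∑ p ∈ Finset.Icc 2 6, ∑ c' : Fin p → ι', E' p c' * ∏ l, B₁ (c' l)) + R₁ -
        ((∑ p ∈ Finset.Icc 2 6, ∑ c : Fin p → ι, E p c * ∏ l, B₀ (c l)) + R₀)| ≤
      (5 * (C_s ^ 2 * C + 6 * C_s * C_B * C_E) + 2 * C_R) * e * x ^ 4 * (θ ^ 2 * ρ + θ ^ 7) := by
  have hx2 : x ^ 2 ≤ 1 := pow_le_one₀ hx0 hx1
  have hs0 : 0 ≤ C_s * θ * x ^ 2 := by positivity
  have hs1 : C_s * θ * x ^ 2 ≤ 1 := by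
    calc C_s * θ * x ^ 2 ≤ 1 * 1 := mul_le_mul hsθ hx2 (by positivity) zero_le_one
      _ = 1 := one_mul 1
  have ht0 : 0 ≤ C_B * θ * x ^ 2 * ρ := by positivity
  have hper : ∀ p ∈ Finset.Icc 2 6,
      |∑ c' : Fin p → ι', E' p c' * ∏ l, B₁ (c' l) - ∑ c : Fin p → ι, E p c * ∏ l, B₀ (c l)| ≤
        (C_s * θ * x ^ 2) ^ 2 * (C * e * ρ) + 6 * (C_s * θ * x ^ 2) * (C_B * θ * x ^ 2 * ρ) * (C_E * e) := by
    intro p hp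
    have hp' := Finset.mem_Icc.mp hp
    exact per_order m hp'.1 hp'.2 (E p) (E' p) B₀ B₁ r hs0 hs1 ht0 hr hB₀ hB₁ hΔ (hK p hp) (hE p hp)
  have eq : (∑ p ∈ Finset.Icc 2 6, ∑ c' : Fin p → ι', E' p c' * ∏ l, B₁ (c' l)) + R₁ -
        ((∑ p ∈ Finset.Icc 2 6, ∑ c : Fin p → ι, E p c * ∏ l, B₀ (c l)) + R₀) =
      (∑ p ∈ Finset.Icc 2 6, (∑ c' : Fin p → ι', E' p c' * ∏ l, B₁ (c' l) - ∑ c : Fin p → ι, E p c * ∏ l, B₀ (c l))) +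
        (R₁ - R₀) := by
    rw [Finset.sum_sub_distrib]; ring
  rw [eq]
  have hcard : (Finset.Icc 2 6).card = 5 := by rfl
  have hM : 0 ≤ C_s ^ 2 * C + 6 * C_s * C_B * C_E :=
    add_nonneg (mul_nonneg (sq_nonneg _) hC) (mul_nonneg (mul_nonneg (mul_nonneg (by norm_num) hCs) hCB) hCE)
  have hx14 : x ^ 14 ≤ x ^ 4 := pow_le_pow_of_le_one hx0 hx1 (by norm_num)
  have hθ7 : 0 ≤ θ ^ 7 := pow_nonneg hθ 7
  calc |(∑ p ∈ Finset.Icc 2 6, (∑ c' : Fin p → ι', E' p c' * ∏ l, B₁ (c' l) - ∑ c : Fin p → ι, E p c * ∏ l, B₀ (c l))) +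
          (R₁ - R₀)|
      ≤ |∑ p ∈ Finset.Icc 2 6, (∑ c' : Fin p → ι', E' p c' * ∏ l, B₁ (c' l) - ∑ c : Fin p → ι, E p c * ∏ l, B₀ (c l))| +
          |R₁ - R₀| := abs_add_le _ _
    _ ≤ (∑ p ∈ Finset.Icc 2 6, |∑ c' : Fin p → ι', E' p c' * ∏ l, B₁ (c' l) - ∑ c : Fin p → ι, E p c * ∏ l, B₀ (c l)|) +
          (|R₁| + |R₀|) := add_le_add (Finset.abs_sum_le_sum_abs _ _) (by simpa [sub_eq_add_neg, abs_neg] using abs_add_le R₁ (-R₀))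
    _ ≤ (∑ p ∈ Finset.Icc 2 6, ((C_s * θ * x ^ 2) ^ 2 * (C * e * ρ) + 6 * (C_s * θ * x ^ 2) * (C_B * θ * x ^ 2 * ρ) * (C_E * e))) +
          (C_R * e * θ ^ 7 * x ^ 14 + C_R * e * θ ^ 7 * x ^ 14) := add_le_add (Finset.sum_le_sum hper) (add_le_add hR₁ hR₀)
    _ = 5 * (C_s ^ 2 * C + 6 * C_s * C_B * C_E) * e * x ^ 4 * (θ ^ 2 * ρ) + 2 * C_R * e * θ ^ 7 * x ^ 14 := by
          rw [Finset.sum_const, hcard, nsmul_eq_mul]; push_cast; ring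
    _ ≤ 5 * (C_s ^ 2 * C + 6 * C_s * C_B * C_E) * e * x ^ 4 * (θ ^ 2 * ρ) + 2 * C_R * e * θ ^ 7 * x ^ 4 := by
          have h2 : 0 ≤ 2 * C_R * e * θ ^ 7 := by positivity
          nlinarith [mul_le_mul_of_nonneg_left hx14 h2]
    _ ≤ (5 * (C_s ^ 2 * C + 6 * C_s * C_B * C_E) + 2 * C_R) * e * x ^ 4 * (θ ^ 2 * ρ + θ ^ 7) := by
          have hA : 0 ≤ 5 * (C_s ^ 2 * C + 6 * C_s * C_B * C_E) * e * x ^ 4 * θ ^ 7 := by positivity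
          have hB : 0 ≤ 2 * C_R * e * x ^ 4 * (θ ^ 2 * ρ) := by positivity
          nlinarith [hA, hB]

/-- **THE LINE'S COMPOSITION (FIRST CHECKABLE STATEMENT, PROVED).**  Taylor structure + flat-kernel Cauchy (K1a) + kernel size + remainder + configuration size +
configuration Cauchy ⟹ the two-cut-off row WITH SLACK `σ = 7`, shifts `c ≡ 0`, constant `5·(C_s²C + 6C_sC_BC_E) + 2C_R`, for a window with `(C_s+C_B)·θ(n) ≤ 1`.
The typed slack-free row needs in addition the all-order kernel comparison at heights `n` not growing with `K` (see the line card, F-idea1-g9-1).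
[cite: King1986, Prop. 3.6 p.662, (3.57) p.662; Balaban1985UV3, (43)-(44) pp.266-267, (57) p.270] -/
theorem polymerCauchyMinAtTSlack_of_taylor {D : AlphaDataT3 F γ} {PT : TermFn F} {E : Kernel F} {B : CfgMapR F} {R : Remainder F} {r : Radius F}
    {b₀ p₀ κ a C C_E C_R C_s C_B : ℝ}
    (hC : 0 ≤ C) (hCE : 0 ≤ C_E) (hCR : 0 ≤ C_R) (hCs : 0 ≤ C_s) (hCB : 0 ≤ C_B) (hL : 1 ≤ (F.L : ℝ))
    (hθ0 : ∀ n, 0 ≤ θBal F.L γ b₀ p₀ n) (hθ1 : ∀ n, (C_s + C_B) * θBal F.L γ b₀ p₀ n ≤ 1) (hr : ∀ K i Y c, 0 ≤ r K i Y c)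
    (hT : TaylorSplit PT E B R) (hK : FlatKernelCauchy D E r κ a C) (hE : KernelSize D E r κ C_E) (hR : RemainderSmall D R b₀ p₀ κ C_R)
    (hS : CfgSize D B r b₀ p₀ C_s) (hBC : CfgCauchy D B r b₀ p₀ a C_B) :
    PolymerCauchyMinAtTSlack D PT b₀ p₀ κ a 7 (5 * (C_s ^ 2 * C + 6 * C_s * C_B * C_E) + 2 * C_R) := by
  refine ⟨fun _ _ _ _ => 0, ?_⟩
  intro K n hn j hj V hV Y hY
  have hSz := hS K n hn j hj V hV Y hY
  have hCy := hBC K n hn j hj V hV Y hY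
  have hRm := hR K n hn j hj V hV Y hY
  have hKc := hK K (K - n) (1 + j) Y hY
  have hEs := hE K (K - n) (1 + j) Y hY
  rw [sub_zero, hT, hT]
  have hsθ : C_s * θBal F.L γ b₀ p₀ n ≤ 1 := by nlinarith [hθ1 n, hθ0 n]
  have hx0 : 0 ≤ ((F.L : ℝ) ^ (K - n - 1 - j))⁻¹ := by positivity
  have hx1 : ((F.L : ℝ) ^ (K - n - 1 - j))⁻¹ ≤ 1 := inv_le_one_of_one_le₀ (one_le_pow₀ hL)
  have hρ : 0 ≤ (((F.L : ℝ) ^ (1 + j))⁻¹) ^ a := Real.rpow_nonneg (by positivity) _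
  exact taylor_core (matchBond F K (1 + j)) (fun p c => E K (1 + j) Y p c) (fun p c' => E (K + 1) (1 + (j + 1)) (refineSet F K Y) p c')
    _ _ (r K (1 + j) Y) _ _ (hθ0 n) hsθ hx0 hx1 hρ (Real.exp_pos _).le hC hCE hCR hCs hCB (hr K (1 + j) Y)
    (fun c => (hSz c).1) (fun c => (hSz c).2) hCy hKc hEs hRm.1 hRm.2

end Schemas

/-! ## §3 Scalar bookkeeping of the order-`p` absorption (why «six») -/

/-- An order-`p` monomial read at fields filling the fraction `θ·x²` of the polydisc (`x = L^{−(K−n−1−j)} ≤ 1`, `θ = θ(n) ≤ 1`) is below the slack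
`θ⁷·x¹⁴` as soon as `p ≥ 7`. [folklore] -/
theorem order_absorb {θ x : ℝ} (hθ0 : 0 ≤ θ) (hθ1 : θ ≤ 1) (hx0 : 0 ≤ x) (hx1 : x ≤ 1) {p : ℕ} (hp : 7 ≤ p) :
    (θ * x ^ 2) ^ p ≤ θ ^ 7 * x ^ 14 := by
  have h1 : (θ * x ^ 2) ^ p ≤ (θ * x ^ 2) ^ 7 :=
    pow_le_pow_of_le_one (by positivity) (by nlinarith [mul_le_one₀ hθ1 (by positivity : 0 ≤ x ^ 2) (pow_le_one₀ hx0 hx1)]) hp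
  calc (θ * x ^ 2) ^ p ≤ (θ * x ^ 2) ^ 7 := h1
    _ = θ ^ 7 * x ^ 14 := by ring

/-- The summability exponent at the socket's height: with `|T_n| ~ L^{3n}` polymers of unit tree length and `θ(n)² ~ L^{−n}` (coupling `γL^{−n}` at the
comparison lattice), the slack sums to `L^{3n}·θ(n)^σ ~ L^{(3 − σ/2)n}`, decaying iff `σ > 6` — the arithmetic behind print's «power greater than six».
Recorded as the inequality `3 − σ/2 < 0 ↔ 6 < σ`. [folklore] -/
theorem six_threshold (σ : ℝ) : 3 - σ / 2 < 0 ↔ 6 < σ := by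
  constructor <;> intro h <;> linarith

end Summit.QuantumFields.YangMills.Cruxes.FluctuationComparisonRegPr.Ideate1Flat

end
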